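import Literature.NumberTheory.GaloisRepresentations.LubinTateUnramifiedNormalBasis
import Literature.NumberTheory.GaloisRepresentations.LubinTateColemanRelativeBaseNormLawsTwo
import HarnessLib

/-!
# The anomaly cokernel is EXACTLY `𝒪_F/(1 − u^{[E:F]})` — de Shalit's `(𝒪/p^N)(1)` with `p^N ∥ p^dξ^{-1} − 1`

De Shalit, *Iwasawa theory of elliptic curves with complex multiplication* (1987), Ch. I §3.7: over the unramified base `k' = E` of degree
`d`, the cokernel of Theorem I.3.7 is `(𝒪/p^N)(1)` where `N` is the largest integer with `p^dξ^{-1} ≡ 1 (mod p^N)`.  In the tree's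
coordinates the cokernel is `C_E = 𝒪_E/(1 − uφ)𝒪_E` (`LubinTateColemanRelativeExact(Principal)Two`), known to be cyclic over `𝒪_F`
(`LubinTateUnramifiedAnomalyCokernel`) and killed by `1 − u^d` (`LubinTateColemanRelativeBaseNormLawsTwo`).  Using the integral normal basis
`(φ^iθ)_{i<d}` (`LubinTateUnramifiedNormalBasis`) this file identifies it EXACTLY: the `𝒪_F`-linear functional
`λ(Σ c_i φ^iθ) = Σ u^{d−1−i} c_i` satisfies `λ ∘ (1 − uφ) = (1 − u^d)·(coefficient of φ^{d−1}θ)`, is onto `𝒪_F`, and (for `u^d ≠ 1`,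
de Shalit's `N < ∞`) `c ∈ (1 − uφ)𝒪_E ⟺ λ(c) ∈ (1 − u^d)` — so **`C_E ≅ 𝒪_F/(1 − u^d)`, of order `q^{v(1−u^d)} = p^N`**.
Everything PROVED (0 sorry, no named facts):

* `finite_quotient_span_of_ne_zero` — `𝒪_F/(a)` is finite for `a ≠ 0`.
* ★★ `exists_functional_anomaly_cokernel` — the functional `λ` with `λ` surjective, `λ((1 − uφ)c') ∈ (1 − u^d)`, and
  `λ(c) ∈ (1 − u^d) → c ∈ (1 − uφ)𝒪_E` (`E ⊆ F^{nr}` finite Galois, `φ` the Frobenius of an arithmetic Frobenius `σ₀`, `u^d ≠ 1`).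
  -- TODO(general form): the case `u^d = 1` (`N = ∞`, `C_E ≅ 𝒪_F`) needs the coordinate recursion instead of the counting step.

## References

* E. de Shalit, *Iwasawa theory of elliptic curves with complex multiplication* (1987), Ch. I §3.7 Theorem (the integer `N`). [deShalit1987]
* J.-P. Serre, *Local Fields* (1979), Ch. I §4 Prop. 10. [SerreLocalFields1979]
-/

noncomputable section

namespace Literature.NumberTheory.GaloisRepresentations

section AnomalyCokernelExact

open GaloisRepresentations.IsNonarchimedeanLocalField LubinTate ValuativeRel Field

variable {F : Type} [Field F] [ValuativeRel F] [TopologicalSpace F] [IsNonarchimedeanLocalField F]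

attribute [local instance] ltNormUniformSpace ltNormIsUniformAddGroup rk1 nF nE fintypeResidueField

omit [TopologicalSpace F] [IsNonarchimedeanLocalField F] in
/-- **`𝒪_F/(a)` is finite for `a ≠ 0`** (`(a) = 𝔪^n`, `𝒪_F/𝔪` finite). [cite: SerreLocalFields1979, Ch. II §1 Prop. 1] -/
theorem finite_quotient_span_of_ne_zero {F : Type} [Field F] [ValuativeRel F] [TopologicalSpace F] [IsNonarchimedeanLocalField F]
    {a : 𝒪[F]} (ha : a ≠ 0) : Finite (𝒪[F] ⧸ Ideal.span {a}) := by
  obtain ⟨ϖ, hϖ⟩ := IsDiscreteValuationRing.exists_irreducible 𝒪[F]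
  obtain ⟨n, hn⟩ := IsDiscreteValuationRing.associated_pow_irreducible ha hϖ
  have h1 : Ideal.span {a} = 𝓂[F] ^ n := by
    rw [Ideal.span_singleton_eq_span_singleton.mpr hn, ← Ideal.span_singleton_pow,
      ← (IsDiscreteValuationRing.irreducible_iff_uniformizer ϖ).mp hϖ]
  haveI : Finite (𝒪[F] ⧸ 𝓂[F]) := inferInstanceAs (Finite 𝓀[F])
  rw [h1]
  exact Ideal.finite_quotient_pow (IsNoetherian.noetherian _) n

variable {π : 𝒪[F]} (hπ : (valuation F).IsUniformizer (π : F))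
variable (E : IntermediateField F (AlgebraicClosure F)) [FiniteDimensional F E] [IsGalois F E]

include hπ in
set_option maxHeartbeats 800000 in
/-- ★★ **The anomaly cokernel is exactly `𝒪_F/(1 − u^{[E:F]})`** (`E ⊆ F^{nr}` finite Galois of degree `d`, `φ` the Frobenius of `𝒪_E`,
`u ∈ 𝒪_F` with `u^d ≠ 1`): there is an `𝒪_F`-linear functional `λ : 𝒪_E → 𝒪_F` (`λ(Σ c_i φ^iθ) = Σ u^{d−1−i}c_i` on an integral
normal basis) which is SURJECTIVE, kills `(1 − uφ)𝒪_E` modulo `(1 − u^d)`, and detects it: `c ∈ (1 − uφ)𝒪_E ⟺ λ(c) ∈ (1 − u^d)𝒪_F`.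
Hence `𝒪_E/(1 − uφ)𝒪_E ≅ 𝒪_F/(1 − u^d)`, cyclic of order `q^{v(1 − u^d)}` — de Shalit's `(𝒪/p^N)(1)`.
[cite: deShalit1987, Ch. I §3.7 Theorem] -/
theorem exists_functional_anomaly_cokernel (hE : E ≤ maxUnramified F) {σ₀ : absoluteGaloisGroup F} (hσ₀ : IsAbsArithFrob σ₀)
    (u : 𝒪[F]) (hud : 1 - u ^ Module.finrank F E ≠ 0) :
    ∃ lam : unitBall E →ₗ[𝒪[F]] 𝒪[F], Function.Surjective lam ∧
      ∀ c : unitBall E,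
        (∃ c' : unitBall E, c = c' - algebraMap 𝒪[F] (unitBall E) u * (frobUnitBall E σ₀ : unitBall E →+* unitBall E) c') ↔
          lam c ∈ Ideal.span {1 - u ^ Module.finrank F E} := by
  classical
  -- notation
  obtain ⟨φ, hφ⟩ : ∃ φ : unitBall E →+* unitBall E, φ = (frobUnitBall E σ₀ : unitBall E →+* unitBall E) := ⟨_, rfl⟩
  obtain ⟨A, hA⟩ : ∃ A : 𝒪[F] →+* unitBall E, A = algebraMap 𝒪[F] (unitBall E) := ⟨_, rfl⟩
  obtain ⟨a, ha⟩ : ∃ a : 𝒪[F], a = 1 - u ^ Module.finrank F E := ⟨_, rfl⟩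
  rw [← hφ, ← hA, ← ha]
  rw [← ha] at hud
  have hφa : ∀ t : 𝒪[F], φ (A t) = A t := fun t => by rw [hφ, hA]; exact unitBallEquiv_algebraMap E _ t
  have hφpow : ∀ c : unitBall E, φ c - c ^ residueFieldCard F ∈ Ideal.span {algebraMap 𝒪[F] (unitBall E) π} := fun c => by
    rw [hφ]; exact unitBallEquiv_sub_pow_mem hπ E hE hσ₀ _ (coe_restrictNormal_apply E σ₀) c
  have hφd : ∀ c : unitBall E, (φ ^ Module.finrank F E) c = c := fun c => by rw [hφ]; exact frobUnitBall_pow_finrank_apply E σ₀ c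
  have hdpos : 0 < Module.finrank F E := Module.finrank_pos
  -- the integral normal basis `b i = φ^i θ`
  obtain ⟨θ, b, hb⟩ := exists_basis_eq_pow_apply hπ E hE (fun t => by rw [← hA]; exact hφa t) hφpow
  -- `φ` as an `𝒪_F`-linear map and its action on the basis
  obtain ⟨φl, hφl⟩ : ∃ φl : unitBall E →ₗ[𝒪[F]] unitBall E, ∀ c, φl c = φ c :=
    ⟨{ toFun := φ, map_add' := map_add φ,
       map_smul' := fun t c => by rw [Algebra.smul_def, Algebra.smul_def, map_mul, RingHom.id_apply, ← hA, hφa] }, fun _ => rfl⟩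
  obtain ⟨ℓ, hℓ⟩ : ∃ ℓ : Fin (Module.finrank F E), (ℓ : ℕ) = Module.finrank F E - 1 := ⟨⟨Module.finrank F E - 1, Nat.sub_lt hdpos one_pos⟩, rfl⟩
  have hφb : ∀ (j : Fin (Module.finrank F E)) (hj : (j : ℕ) + 1 < Module.finrank F E), φ (b j) = b ⟨(j : ℕ) + 1, hj⟩ :=
      fun j hj => by
    rw [hb, hb, pow_succ', RingHom.mul_def, RingHom.comp_apply]
  have hφℓ : φ (b ℓ) = b ⟨0, hdpos⟩ := by
    rw [hb, hb, ← RingHom.comp_apply, ← RingHom.mul_def, ← pow_succ', hℓ, Nat.sub_add_cancel hdpos, hφd, pow_zero,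
      RingHom.one_def, RingHom.id_apply]
  -- the functional `λ = Σ u^{d-1-j} coord_j`
  obtain ⟨lam, hlam⟩ : ∃ lam : unitBall E →ₗ[𝒪[F]] 𝒪[F],
      lam = ∑ j : Fin (Module.finrank F E), u ^ (Module.finrank F E - 1 - (j : ℕ)) • b.coord j := ⟨_, rfl⟩
  have hlam_b : ∀ j : Fin (Module.finrank F E), lam (b j) = u ^ (Module.finrank F E - 1 - (j : ℕ)) := fun j => by
    rw [hlam, LinearMap.sum_apply, Finset.sum_eq_single j]
    · rw [LinearMap.smul_apply, Module.Basis.coord_apply, Module.Basis.repr_self, Finsupp.single_eq_same, smul_eq_mul, mul_one]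
    · intro i _ hij
      rw [LinearMap.smul_apply, Module.Basis.coord_apply, Module.Basis.repr_self, Finsupp.single_eq_of_ne hij, smul_zero]
    · intro h; exact absurd (Finset.mem_univ j) h
  -- ★ the key identity `λ − u·(λ ∘ φ) = a · coord_ℓ`
  have hkey : lam - u • (lam ∘ₗ φl) = a • b.coord ℓ := by
    refine b.ext fun j => ?_
    rw [LinearMap.sub_apply, LinearMap.smul_apply, LinearMap.comp_apply, hφl, LinearMap.smul_apply, Module.Basis.coord_apply,
      Module.Basis.repr_self, smul_eq_mul, smul_eq_mul, hlam_b]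
    by_cases hj : (j : ℕ) + 1 < Module.finrank F E
    · rw [hφb j hj, hlam_b, Finsupp.single_eq_of_ne (fun h => by rw [h] at hℓ; omega), mul_zero]
      have e : Module.finrank F E - 1 - (j : ℕ) = (Module.finrank F E - 1 - ((j : ℕ) + 1)) + 1 := by omega
      rw [e, pow_succ']
      exact sub_self _
    · have hjℓ : j = ℓ := Fin.ext (by omega)
      subst hjℓ
      rw [hφℓ, hlam_b, Finsupp.single_eq_same, mul_one, Fin.val_mk, hℓ, Nat.sub_self, pow_zero, Nat.sub_zero, ← pow_succ',
        Nat.sub_add_cancel hdpos, ha]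
  have hkey' : ∀ c : unitBall E, lam (c - A u * φ c) = a * b.coord ℓ c := fun c => by
    have h1 := congrArg (fun f : unitBall E →ₗ[𝒪[F]] 𝒪[F] => f c) hkey
    simp only [LinearMap.sub_apply, LinearMap.smul_apply, LinearMap.comp_apply, hφl, smul_eq_mul] at h1
    rw [map_sub, ← h1, sub_right_inj, hA, ← Algebra.smul_def, map_smul, smul_eq_mul]
  refine ⟨lam, fun t => ⟨t • b ℓ, by rw [map_smul, hlam_b, hℓ, Nat.sub_self, pow_zero, smul_eq_mul, mul_one]⟩, fun c => ⟨?_, ?_⟩⟩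
  · -- `(→)`: `λ((1 − uφ)c') = a · c'_ℓ`
    rintro ⟨c', rfl⟩
    rw [hkey']
    exact Ideal.mul_mem_right _ _ (Ideal.mem_span_singleton_self a)
  · -- `(←)`: counting — the cokernel is cyclic and killed by `a`, `λ̄` is onto `𝒪_F/(a)`, `𝒪_F/(a)` is finite
    intro hc
    obtain ⟨T, hT⟩ : ∃ T : unitBall E →ₗ[𝒪[F]] unitBall E, ∀ c', T c' = c' - A u * φ c' :=
      ⟨LinearMap.id - (LinearMap.mulLeft 𝒪[F] (A u)).comp φl, fun c' => by
        rw [LinearMap.sub_apply, LinearMap.id_apply, LinearMap.comp_apply, LinearMap.mulLeft_apply, hφl]⟩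
    suffices h : c ∈ LinearMap.range T by
      obtain ⟨c', hc'⟩ := h
      exact ⟨c', by rw [← hT, hc']⟩
    -- `λ̄ : 𝒪_E / range T → 𝒪_F / (a)`
    have hcomp : LinearMap.range T ≤ LinearMap.ker ((Ideal.span {a}).mkQ ∘ₗ lam) := by
      rintro _ ⟨c', rfl⟩
      rw [LinearMap.mem_ker, LinearMap.comp_apply, Submodule.mkQ_apply, Submodule.Quotient.mk_eq_zero, hT, hkey']
      exact Ideal.mul_mem_right _ _ (Ideal.mem_span_singleton_self a)
    obtain ⟨lamb, hlamb⟩ : ∃ lamb : (unitBall E ⧸ LinearMap.range T) →ₗ[𝒪[F]] (𝒪[F] ⧸ Ideal.span {a}),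
        lamb = (LinearMap.range T).liftQ ((Ideal.span {a}).mkQ ∘ₗ lam) hcomp := ⟨_, rfl⟩
    have hlamb_mk : ∀ x : unitBall E, lamb (Submodule.Quotient.mk x) = Submodule.Quotient.mk (lam x) := fun x => by
      rw [hlamb]; rfl
    -- finiteness and the bound `|𝒪_E / range T| ≤ |𝒪_F/(a)|`
    haveI hfa : Finite (𝒪[F] ⧸ Ideal.span {a}) := finite_quotient_span_of_ne_zero hud
    obtain ⟨c₀, hc₀⟩ := exists_forall_exists_eq_add_sub_mul hπ E hE (ψ := φ) (fun t => by rw [← hA]; exact hφa t) hφpow u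
    obtain ⟨g, hg⟩ : ∃ g : (𝒪[F] ⧸ Ideal.span {a}) →ₗ[𝒪[F]] (unitBall E ⧸ LinearMap.range T),
        ∀ t : 𝒪[F], g (Submodule.Quotient.mk t) = Submodule.Quotient.mk (t • c₀) := by
      have hker : Ideal.span {a} ≤ LinearMap.ker ((LinearMap.range T).mkQ ∘ₗ (LinearMap.toSpanSingleton 𝒪[F] (unitBall E) c₀)) := by
        rw [Ideal.span_singleton_le_iff_mem, LinearMap.mem_ker, LinearMap.comp_apply, LinearMap.toSpanSingleton_apply,
          Submodule.mkQ_apply, Submodule.Quotient.mk_eq_zero]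
        obtain ⟨c', hc'⟩ := exists_sub_mul_frobUnitBall_eq (E := E) σ₀ (LTCoeff.of F u) c₀
        refine ⟨c', ?_⟩
        rw [hT, hA, hφ, Algebra.smul_def, ha, map_sub, map_one, map_pow]
        exact hc'
      exact ⟨(Ideal.span {a}).liftQ _ hker, fun t => rfl⟩
    have hgsurj : Function.Surjective g := by
      intro y
      obtain ⟨x, rfl⟩ := Submodule.Quotient.mk_surjective (LinearMap.range T) y
      obtain ⟨t, c', hx⟩ := hc₀ x
      refine ⟨Submodule.Quotient.mk t, ?_⟩
      rw [hg, eq_comm, Submodule.Quotient.eq]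
      refine ⟨c', ?_⟩
      rw [hT, hx, hA, Algebra.smul_def]
      ring
    haveI hfQ : Finite (unitBall E ⧸ LinearMap.range T) := Finite.of_surjective g hgsurj
    have hcardle : Nat.card (unitBall E ⧸ LinearMap.range T) ≤ Nat.card (𝒪[F] ⧸ Ideal.span {a}) :=
      Nat.card_le_card_of_surjective g hgsurj
    have hlsurj : Function.Surjective lamb := by
      intro y
      obtain ⟨t, rfl⟩ := Submodule.Quotient.mk_surjective (Ideal.span {a}) y
      refine ⟨Submodule.Quotient.mk (t • b ℓ), ?_⟩
      rw [hlamb_mk, map_smul, hlam_b, hℓ, Nat.sub_self, pow_zero, smul_eq_mul, mul_one]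
    have hbij := @Function.Surjective.bijective_of_nat_card_le _ _ hfQ _ hlsurj hcardle
    -- conclude
    have h0 : lamb (Submodule.Quotient.mk c) = 0 := by
      rw [hlamb_mk, Submodule.Quotient.mk_eq_zero]
      exact hc
    have h1 : Submodule.Quotient.mk (p := LinearMap.range T) c = 0 := hbij.1 (by rw [h0, map_zero])
    exact (Submodule.Quotient.mk_eq_zero _).mp h1

end AnomalyCokernelExact

end Literature.NumberTheory.GaloisRepresentations
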